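import Mathlib
import HarnessLib
import HarnessLib.Audit
import Summits.Langlands.Statement
import Summits.Langlands.Langlands.Theses.WeightMultiplicitySplit
import Literature.NumberTheory.GaloisRepresentations.LabelledHodgeTateWeights
import Literature.NumberTheory.PAdicHodge.FontaineDpst
import HarnessLib.Audit.Status.Attr

/-!
Route: MinusculeHodgeTypeSplit

# Route MinusculeHodgeTypeSplit — the wall-type primitive residual W_Prim is «three classical PEL
pictures + a Griffiths-rigid remainder»: cut by the MINUSCULE / NON-MINUSCULE dichotomy of the
Hodge–Tate cocharacter, attack the abelian-surface picture with the BCGP engine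

Decomposition node of the Langlands root ladder (cell decomp-langlands, lens 2 «structural
dichotomy: special vs generic», gen 11; RESIDUAL MODE, blocker first).
TARGET = W_Prim `WeightMultiplicitySplit.WallLieIrreducibleAutomorphy` stmt-Langlands-33605, the
DECLARED RESIDUAL of the wall chamber of route-Langlands-WeightMultiplicitySplit
rev 2 (a LAYER-2 item: child of W = WallWeightReciprocity 24354 by the g10 split) — hence a child
route (`--refines WeightMultiplicitySplit:WallLieIrreducibleAutomorphy`), never re-typed,
used BY NAME through the FRAME.  THESIS X = MIN2 ∧ MIN3 ∧ MIN4 ∧ R (∧ FRAME): it suffices to show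
clause (B) for the wall-type Lie-irreducible non-potentially-scalar ρ separately on
the MINUSCULE Hodge types of rank ≤ 4 — which on paper are exactly the weight-one type (n ≤ 2: empty
by Sen + Fontaine–Mazur 5a, a theorem on the odd sector), the Picard U(2,1)
type (n = 3) and the abelian-surface type (n = 4: the one irregular Hodge type with a
potential-automorphy / modularity ENGINE, BCGP 2021/2025) — and on the NON-MINUSCULE
remainder R (Hodge length ≥ 2 somewhere, or rank ≥ 5: Griffiths-rigid, no family witness, no Shimura
realisation; the new DECLARED RESIDUAL).  The split is EXACT:
W_Prim ⟺ MIN2 ∧ MIN3 ∧ MIN4 ∧ R by excluded middle on the inlined dial and `omega` (kernel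
`wallLieIrreducible_iff_cells`, 0 sorry, mod NOTHING), every cell ⟸ Langlands,
and FRAME (= the host route verbatim, certified from the host's `closes` + the landed W-split glue +
G, W_A, W_Fin, W_Str, D) carries W_Prim to Langlands.
Lean: `closes : MinusculeWallRankTwoAutomorphy → MinusculeWallRankThreeAutomorphy →
MinusculeWallRankFourAutomorphy → NonMinusculeWallAutomorphy → WallLieIrreducibleFrame →
_root_.Langlands`.

Rationale: WHY THIS LINE. The special/generic dichotomy that actually governs what is PROVABLE about
irregular-weight reciprocity is not «regular vs irregular» (the host's cut) nor «finite vs infinite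
monodromy» (g10's), but whether the Hodge–Tate cocharacter is MINUSCULE: Deligne's axiom (SV1) /
Green–Griffiths–Kerr's condition (ii) «only z, 1, z⁻¹ occur in Ad μ»
[corpus:book:green2012-mumford-tate-groups-domains-their-geometry-arithmetic p.17 L1–3, p.18 L13;
corpus:book:editornd-shimura-varieties p.72 L9, p.94 L9] is exactly the condition under which the
Hodge datum is of abelian-variety / Shimura type, the period domain is Hermitian symmetric with
trivial infinitesimal period relation, the objects MOVE IN ALGEBRAIC FAMILIES (abelian schemes), and
therefore Moret-Bailly pq-switches, higher Hida/Coleman theory on a PEL Shimura variety and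
Taylor–Wiles patching in irregular weight are available — every irregular-weight automorphy theorem
in print lives there (weight-one forms: Buzzard–Taylor … Pilloni–Stroh; abelian surfaces: BCGP 2021
Thm 1.1.3, BCGP 2025 [corpus:paper:arxiv-2510.02756 p.5–6]). Its complement is GGK's NON-CLASSICAL
world: Griffiths transversality bites, family witnesses do not exist for gapped weights (tree
barrier `FamilyWitnessConsecutiveWeights_holds`), no Shimura variety realises the form (tree barrier
`ShimuraVarietyRealizationBarrier`), and the only foothold is Carayol's degenerate-limit programme
for SU(2,1) [ibid. p.27 L15–19] and CG18's minimal lifting in the gapped GSp₄ weights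
[corpus:paper:arxiv-2109.14145 p.27]. Combined with the WALL condition (multiplicity exactly 2) the
minuscule world is FINITE IN RANK on paper: a minuscule multiset with multiplicities ≤ 2 has at most
four elements (node certificate `card_le_four_of_minuscule_wall`), and the three surviving shapes
{a,a}, {a,a,a+1}, {a,a,a+1,a+1} are precisely the three classical low-rank PEL pictures
(modular/Hilbert weight one, Picard, Siegel/abelian surface). So the cut isolates, inside the host's
darkest residual, the ONE cell where an engine exists (MIN4) from two small named exotics (MIN2
empty-by-conjecture, MIN3 Picard type) and an honestly-labelled rigid remainder R. Imported: Hodge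
theory of period domains (Deligne, Griffiths, GGK) as the organising dichotomy; arithmetic of
abelian surfaces (BCGP) as the engine. What prior routes do not do: the host cuts by weight
multiplicity, g10 by monodromy type, lens-5-g4 SenBridgeSplit by the HT-SCALAR type (⊊ MIN2),
lens-6-g12 by gap-free/interval weights (interval ⊋ minuscule: {0,0,1,2} is gap-free,
non-minuscule), lens-3-g8 HolomorphicLimitSplit by holomorphic LDS at ∞ (⊋ minuscule: (k,2)-Siegel k
≥ 3 and partial weight one are holomorphic limits but non-minuscule), lens-1-g5/lens-6-g10 by
ordinarity; none isolates the abelian-type locus, and none states the rank-finiteness of the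
engine-bearing world.
RANKED CRUXES. 2 · MinusculeWallRankFourAutomorphy (attacked; engine BCGP; BC5 rung =
`bcgp2025_modThreeSurjective_modular_abelianSurface` by name) · 3 · MinusculeWallRankTwoAutomorphy
(residual conjunct; empty by FM5a + Sen on paper, theorem on the odd TR sector) · 4 ·
MinusculeWallRankThreeAutomorphy (residual conjunct; Picard type, (A)-side only in print) · 5 ·
NonMinusculeWallAutomorphy (DECLARED RESIDUAL; barrier head-on). Support: WallLieIrreducibleFrame
(the host route by name). Assembly = `closes`.
KILL CRITERIA. (i) Each cell is Langlands-implied (kernel `…_of_langlands`), so no cell is refutable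
short of refuting reciprocity; the route dies by STERILITY, not refutation: if the abelian-surface
sector of MIN4 cannot be upgraded from potential automorphy to automorphy over F for ANY F beyond ℚ
within the programme's horizon, the attacked conjunct has no second rung and the route should be
parked FRONTIER. (ii) A typing kill: if the pinned labelled-weights accessor returns JUNK multisets
for which «minuscule» is vacuous or contradictory (e.g. empty multisets at every label making
MIN-cells swallow everything), bc7 P2/P3 would flag it — verdicts CLEAN ×5 recorded; a refuter
reproducing `crux.hyps-vacuous` on any cell kills the cut as typed. (iii) If a refuter shows MIN2
FALSE (an FM-violating Lie-irreducible weight-one-type ρ), W_Prim, W and Langlands fall with it —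
informative either way.
NOT DECOMPOSED YET. MIN4's two sectors (abelian-surface realised / not) are stubs, not items (BC3
skeleton); the Kronecker and induced loci inside each cell are settled by the IH + print and are not
items; R is not cut further (rank ≥ 5 vs low-rank non-minuscule is its skeleton); the (A)-direction
and the finite / imprimitive monodromy types are the host's sibling items W_A, W_Fin, W_Str inside
FRAME. Provers attach lemmas with --supports; no third layer.
CHEAPEST FALSIFIER. Run `#h21_crux_probe` P2/P3 on MIN2 with the battery budget doubled (is
«minuscule ∧ wall ∧ n ≤ 2» satisfiable for the tree's pinned accessor, or does `card`-freeness junk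
make it vacuous?) and try `example : ¬ MinusculeWallRankTwoAutomorphy` / `example :
MinusculeWallRankTwoAutomorphy` by `simp`/`aesop` after unfolding — one `lean check`, minutes; of
record: bc7 VERDICT CLEAN on all four cells and the frame (P1–P5 ok), probes B/C all fail as
claimed.
NUMBERS. Kernel: 1 node file (0 sorry, axioms propext/Classical.choice/Quot.sound), W_Prim ⟺ 4 cells
EXACT; cone = 5 load-bearing binders (4 cruxes + FRAME); bc7 5/5 CLEAN; birth skeletons 4 (2 stubs
each, sorries = stubs); minuscule-wall shapes: 3 (ranks 2, 3, 4), none in rank ≥ 5 (certificate).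
SOURCES. BoxerEtAl2021; arXiv:2502.20645; arXiv:2510.02756; CalegariGeraghty2018; arXiv:2109.14145;
arXiv:1507.05032; arXiv:2111.04834; arXiv:2603.02014; doi:10.1515/9781400842735
(Green–Griffiths–Kerr 2012); book:editornd-shimura-varieties (Genestier–Ngô);
FontaineMazurGeometric1995; BuzzardGeeLMS2014;
Literature/Barriers/Langlands/{NonRegularWeightBarrier,FamilyWitnessConsecutiveWeights,ShimuraVarietyRealizationBarrier}.lean.

Novelty: Searches RUN (2026-08-30; corpus fts+vec AND galaxy, labelled): `lit search --hybrid "minuscule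
Hodge-Tate cocharacter irregular weight automorphy abelian type Galois representation"` → 10 docs,
none organising irregular reciprocity by minusculity ([corpus:book:emerton2022-moduli-stacks…
p.130/223] crystalline lifts, [corpus:paper:arxiv-2312.01551] potential automorphy — regular
weight); `lit vsearch "<the minuscule / non-classical dichotomy in prose>" -k 8` →
[corpus:book:carlson2017-period-mappings-period-domains pp.1, 388, 404],
[corpus:book:kerr2016-recent-advances-hodge-theory-period-domains-algebraic pp.14–15],
[corpus:book:green2012-mumford-tate-groups-domains-their-geometry-arithmetic pp.18–19, 52, 229] —
the classical/non-classical dichotomy of Mumford–Tate domains on the HODGE side only (confirmed by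
`lit read … --grep`: [corpus:book:green2012-mumford-tate-groups-domains-their-geometry-arithmetic
p.17 L1–3, p.18 L13, p.27 L15–19 (Carayol SU(2,1)), p.146 L3]); none couples it to automorphy
lifting; `lit read book:editornd-shimura-varieties --grep minuscule` →
[corpus:book:editornd-shimura-varieties p.72 L9 («SD1 ⟹ weights {−1,0,1}: minuscule»), p.94 L9];
`lit galaxy search "minuscule Hodge-Tate|minuscule cocharacter|Hodge-Tate cocharacter" --star all -n
12` → 15 rows: [galaxy:pdf:4738513865294881560] Booher–Levin G-valued crystalline deformation rings
(local, Fontaine–Laffaille range), [galaxy:pdf:2754149605153708060] Smithling local models,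
[galaxy:panama:3112047403  [refs: book:emerton2022-moduli-stacks, paper:arxiv-2312.01551, book:carlson2017-period-mappings-period-domains, book:kerr2016-recent-advances-hodge-theory-period-domains-algebraic, book:green2012-mumford-tate-groups-domains-their-geometry-arithmetic, book:editornd-shimura-varieties, paper:arxiv-2111.04834, paper:arxiv-2510.02756, paper:arxiv-2109.14145, paper:arxiv-1507.05032]

Barriers (technique_class: shimura-varieties, higher-hida, irregular-weight-TW): - technique_class: shimura-varieties, higher-hida-theory, irregular-weight-taylor-wiles,
potential-automorphy-abelian-varieties, hodge-theory-period-domains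
- Literature.Barriers.Langlands.NonRegularWeightBarrier (NonRegularWeightBarrier_holds /
…Narrow_holds): ALL four cells sit INSIDE its scope (every ρ here is irregular). MIN4 evades it
exactly as BCGP do — by working on the Siegel threefold where weight (2,2) classes live in COHERENT
cohomology H⁰/H¹ of an automorphic vector bundle and higher Hida theory replaces the Betti/étale
realisation the barrier quantifies over; MIN2's print sector evades it by weight-one gluing of
overconvergent forms (Buzzard–Taylor/Kassaei); MIN3 and R do NOT evade it: declared residual
conjuncts, the bet being that R is the honest remainder and MIN3 the smallest named open case
(Picard type).
- Literature.Barriers.Langlands.FamilyWitnessConsecutiveWeights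
(FamilyWitnessConsecutiveWeights_holds): minuscule types are INTERVAL types ({a,a+1}-supported), so
MIN2/3/4 are outside its negative scope (family witnesses may exist and do: Hida/Coleman families on
the PEL Shimura variety); the GAPPED part of R ([0,0,k−1,k−1], k ≥ 4; {a,a,a+k}) is inside: no
family witness — there the only print tool is MINIMAL lifting (CG18), recorded as such.
- Literature.Barriers.Langlands.ShimuraVarietyRealizationBarrier
(ShimuraVarietyRealizationBarrier_holds): MIN4 on the polarised-odd totally-real sector is OUTSIDE
(the Siegel threefold realises weight (2,2) in coher

sub-problem: Langlands · status: draft · opened planner-decomp-langlands-writer-1-g4-0 2026-08-30T16:25:41Z · rev 0 · ledger route-Langlands-MinusculeHodgeTypeSplit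
GENERATED by the gate from the ledger (D-0016/17). Provers cite these decls: `theorem foo : Summit.Langlands.Langlands.Theses.MinusculeHodgeTypeSplit.<Decl> := …` in Summits/Langlands/Langlands/Theorems/<Name>.lean.
-/

namespace Summit.Langlands.Langlands.Theses.MinusculeHodgeTypeSplit

open scoped BigOperators Topology Manifold Classical MeasureTheory ProbabilityTheory Matrix InnerProductSpace ComplexConjugate ContinuousMap
open Filter Set Function TopologicalSpace MeasureTheory

attribute [summit_statement] _root_.Langlands

/-- item stmt-Langlands-27004 · crux · rank 2 · open · by planner
why it might fail: The engine needs F totally real, ρ symplectic with odd multiplier, p small and ρ ordinary p-distinguished (BCGP); over CM F, for unpolarised ρ, or non-ordinary at every p nothing lifts in weight (2,2); as typed (all F, `Corresponds` at ramified places) it exceeds print everywhere.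
sources: BoxerEtAl2021 Thm 1.1.3 = arXiv:1812.09269 (arXiv text p. 3; Thm 9.3.x p. 160 — locators from the cite tag of tree fact Literature.NumberTheory.Automorphic.bcgp2021_potentiallyAutomorphic_abelianSurface), arXiv:2502.20645 Thm A (BCGP 2025; §1.1, TeX chunk p0003 L7–28 — locator from the cite tag of tree fact Literature.NumberTheory.DiophantineGeometry.bcgp2025_modThreeSurjective_modular_abelianSurface), arXiv:2510.02756 [corpus:paper:arxiv-2510.02756 p.5 L23 (ordinary, p-distinguished, HT weights 0,0,1,1), p.6 L26–29 (k = 2 irregular)], CalegariGeraghty2018 = arXiv:1207.4224; Calegari survey arXiv:2109.14145 [corpus:paper:arxiv-2109.14145 p.27 L12–28], Literature.NumberTheory.Automorphic.Ramakrishnan2000_theoremM, Literature/Barriers/Langlands/NonRegularWeightBarrier.lean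
[crux] MIN4 — ABELIAN-SURFACE HODGE TYPE (the ATTACKED conjunct; ATTACKABLE-BY-ENGINE). Every cell
is the host residual W_Prim = `WeightMultiplicitySplit.WallLieIrreducibleAutomorphy`
(stmt-Langlands-33605) VERBATIM with ONE extra conjunct on the bound ρ: GIVEN multiplicity-≤-2
reciprocity below rank n over every number field (the IH), clause (B) «Galois ⟹ cuspidal L-algebraic
automorphic with `Corresponds`» for the irreducible pinned-geometric ρ : Γ_F → GL_n(ℚ̄_ℓ) of WALL
Hodge–Tate type (a labelled weight of multiplicity 2, none of multiplicity ≥ 3) with PRIMITIVE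
INFINITE monodromy (Lie-irreducible, not potentially scalar) — every F, n, datum, level, ℓ, ι.
EXTRA: the Hodge–Tate cocharacter of ρ is MINUSCULE and n = 4 (MINUSCULE means: at every v ∣ ℓ and
every label τ the labelled Hodge–Tate weights lie in {a_τ, a_τ+1} (⟺ ad∘μ_HT has weights in
{−1,0,1}, Deligne's (SV1) / Green–Griffiths–Kerr's «classical» condition (ii): the Hodge datum is of
Shimura = abelian-variety type)), i.e. labelled type {a,a,a+1,a+1} at every label: the Hodge type of
an abelian surface / of a weight-2 Siegel or U(2,2) form, over ANY number field, polarised or not.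
This is the ONE irregular Hodge type wit -/
@[route_item "route-Langlands-MinusculeHodgeTypeSplit", crux]
def MinusculeWallRankFourAutomorphy : Prop :=
  ∀ (F : Type) [Field F] [NumberField F] (Rd : Summit.Langlands.ReciprocityData F) (n : ℕ), 0 < n → ∀ hcpt : Literature.NumberTheory.Automorphic.isCompact_glFiniteIntegralLevel n F, (∀ (m : ℕ), m < n → 0 < m → ∀ (L : Type) [Field L] [NumberField L] (RdL : Summit.Langlands.ReciprocityData L) (hcptL : Literature.NumberTheory.Automorphic.isCompact_glFiniteIntegralLevel m L), (∀ π : Literature.NumberTheory.Automorphic.CuspidalAutomorphicRepData m L hcptL, π.1.IsLAlgebraic → (∃ T : Literature.NumberTheory.Automorphic.InfinityType L m, π.1.HasInfinityType T ∧ ∀ (σ : L →+* ℂ) (a : ℂ), ((T σ).map Literature.NumberTheory.Automorphic.ArchWeight.a).count a ≤ 2) → ∀ (ℓ : ℕ) [Fact ℓ.Prime] (ι : PadicAlgCl ℓ ≃+* ℂ), ∃ ρ : Literature.NumberTheory.GaloisRepresentations.FramedGaloisRep L (PadicAlgCl ℓ) m, ρ.toGaloisRep.IsIrreducible ∧ Summit.Langlands.IsGeometricFramed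 RdL ρ ∧ Summit.Langlands.Corresponds RdL ι π.1 ρ ∧ ∀ ρ' : Literature.NumberTheory.GaloisRepresentations.FramedGaloisRep L (PadicAlgCl ℓ) m, Summit.Langlands.Corresponds RdL ι π.1 ρ' → Summit.Langlands.IsConjugate ρ ρ') ∧ (∀ (ℓ : ℕ) [Fact ℓ.Prime] (ι : PadicAlgCl ℓ ≃+* ℂ) (ρ : Literature.NumberTheory.GaloisRepresentations.FramedGaloisRep L (PadicAlgCl ℓ) m), ρ.toGaloisRep.IsIrreducible → Summit.Langlands.IsGeometricFramed RdL ρ → (∀ (v : IsDedekindDomain.HeightOneSpectrum (NumberField.RingOfIntegers L)) (hv : ((ℓ : ℕ) : NumberField.RingOfIntegers L) ∈ v.asIdeal) (τ : v.adicCompletion L →+* PadicAlgCl ℓ), Continuous τ → ∀ w : ℤ, (ρ.labelledHodgeTateWeightsAt v (Literature.NumberTheory.PAdicHodge.fontainePstAdicCompletion v ℓ hv).algebra (Literature.NumberTheory.PAdicHodge.fontainePstAdicCompletion v ℓ hv).𝔅 τ).count w ≤ 2) → ∃ π : Literature.NumberTheory.Automorphic.CuspidalAutomorphicRepData m L hcptL,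 π.1.IsLAlgebraic ∧ Summit.Langlands.Corresponds RdL ι π.1 ρ)) → (∀ (ℓ : ℕ) [Fact ℓ.Prime] (ι : PadicAlgCl ℓ ≃+* ℂ) (ρ : Literature.NumberTheory.GaloisRepresentations.FramedGaloisRep F (PadicAlgCl ℓ) n), ρ.toGaloisRep.IsIrreducible → Summit.Langlands.IsGeometricFramed Rd ρ → (((¬ (∀ (v : IsDedekindDomain.HeightOneSpectrum (NumberField.RingOfIntegers F)) (hv : ((ℓ : ℕ) : NumberField.RingOfIntegers F) ∈ v.asIdeal) (τ : v.adicCompletion F →+* PadicAlgCl ℓ), Continuous τ → ∀ w : ℤ, (ρ.labelledHodgeTateWeightsAt v (Literature.NumberTheory.PAdicHodge.fontainePstAdicCompletion v ℓ hv).algebra (Literature.NumberTheory.PAdicHodge.fontainePstAdicCompletion v ℓ hv).𝔅 τ).count w ≤ 1) ∧ (∀ (v : IsDedekindDomain.HeightOneSpectrum (NumberField.RingOfIntegers F)) (hv : ((ℓ : ℕ) : NumberField.RingOfIntegers F) ∈ v.asIdeal) (τ : v.adicCompletion F →+* PadicAlgCl ℓ), Continuous τ → ∀ w : ℤ, (ρ.labelledHodgeTateWeightsAt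 v (Literature.NumberTheory.PAdicHodge.fontainePstAdicCompletion v ℓ hv).algebra (Literature.NumberTheory.PAdicHodge.fontainePstAdicCompletion v ℓ hv).𝔅 τ).count w ≤ 2)) ∧ (¬ (∃ (L : Type) (_ : Field L) (_ : NumberField L) (_ : Algebra F L), ∀ σ : Field.absoluteGaloisGroup L, ∃ c : PadicAlgCl ℓ, ((ρ.restrictField L σ : GL (Fin n) (PadicAlgCl ℓ)) : Matrix (Fin n) (Fin n) (PadicAlgCl ℓ)) = c • (1 : Matrix (Fin n) (Fin n) (PadicAlgCl ℓ))) ∧ (∀ (L : Type) [Field L] [NumberField L] [Algebra F L], (ρ.restrictField L).toGaloisRep.IsIrreducible))) ∧ ((∀ (v : IsDedekindDomain.HeightOneSpectrum (NumberField.RingOfIntegers F)) (hv : ((ℓ : ℕ) : NumberField.RingOfIntegers F) ∈ v.asIdeal) (τ : v.adicCompletion F →+* PadicAlgCl ℓ), Continuous τ → ∃ a : ℤ, ∀ w ∈ (ρ.labelledHodgeTateWeightsAt v (Literature.NumberTheory.PAdicHodge.fontainePstAdicCompletion v ℓ hv).algebra (Literature.NumberTheory.PAdicHodge.fontainePstAdicCompletion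 v ℓ hv).𝔅 τ), w = a ∨ w = a + 1) ∧ n = 4)) → ∃ π : Literature.NumberTheory.Automorphic.CuspidalAutomorphicRepData n F hcpt, π.1.IsLAlgebraic ∧ Summit.Langlands.Corresponds Rd ι π.1 ρ)

/-- item stmt-Langlands-27005 · crux · rank 3 · open · by planner
why it might fail: Emptiness rests on Fontaine–Mazur 5a + Hodge–Tate symmetry for ABSTRACT ρ (both open); a Lie-irreducible a.e.-unramified de Rham ρ with all labelled weights {a,a} and infinite image would be a counterexample to FM, and then no π exists (weight-one π have finite-image ρ): the cell would be FALSE.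
sources: FontaineMazurGeometric1995 Conj. 5a, Sen1973 (Ann. of Math. 97) continuous cohomology / C-admissible ⟹ finite inertia, BuzzardTaylor1999 = [corpus:paper:arxiv-2109.14145 p.30 ref [33]], PilloniStroh2016 (weight one Hilbert forms, Ann. Math. Québec 40), arXiv:2111.04834 [corpus:paper:arxiv-2111.04834 p.30 L45–55: «no results have appeared for forms of partial weight one»], Summit.Langlands.Langlands.Theses.SenBridgeSplit (lens-5 items EV stmt-Langlands-29752)
[crux] MIN2 — WEIGHT-ONE HODGE TYPE WITH INFINITE PRIMITIVE MONODROMY («vanishing in disguise»;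
DECLARED RESIDUAL conjunct of this route). Every cell is the host residual W_Prim =
`WeightMultiplicitySplit.WallLieIrreducibleAutomorphy` (stmt-Langlands-33605) VERBATIM with ONE
extra conjunct on the bound ρ: GIVEN multiplicity-≤-2 reciprocity below rank n over every number
field (the IH), clause (B) «Galois ⟹ cuspidal L-algebraic automorphic with `Corresponds`» for the
irreducible pinned-geometric ρ : Γ_F → GL_n(ℚ̄_ℓ) of WALL Hodge–Tate type (a labelled weight of
multiplicity 2, none of multiplicity ≥ 3) with PRIMITIVE INFINITE monodromy (Lie-irreducible, not
potentially scalar) — every F, n, datum, level, ℓ, ι. EXTRA: minuscule Hodge–Tate cocharacter and n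
≤ 2 (MINUSCULE means: at every v ∣ ℓ and every label τ the labelled Hodge–Tate weights lie in {a_τ,
a_τ+1} (⟺ ad∘μ_HT has weights in {−1,0,1}, Deligne's (SV1) / Green–Griffiths–Kerr's «classical»
condition (ii): the Hodge datum is of Shimura = abelian-variety type)): labelled types {a,a} (wall)
at some labels and {b,b} / {b,b+1} at the others — the Hodge type of a weight-one form, but with
image neither finite modulo centre (that i -/
@[route_item "route-Langlands-MinusculeHodgeTypeSplit", crux]
def MinusculeWallRankTwoAutomorphy : Prop :=
  ∀ (F : Type) [Field F] [NumberField F] (Rd : Summit.Langlands.ReciprocityData F) (n : ℕ), 0 < n → ∀ hcpt : Literature.NumberTheory.Automorphic.isCompact_glFiniteIntegralLevel n F, (∀ (m : ℕ), m < n → 0 < m → ∀ (L : Type) [Field L] [NumberField L] (RdL : Summit.Langlands.ReciprocityData L) (hcptL : Literature.NumberTheory.Automorphic.isCompact_glFiniteIntegralLevel m L), (∀ π : Literature.NumberTheory.Automorphic.CuspidalAutomorphicRepData m L hcptL, π.1.IsLAlgebraic → (∃ T : Literature.NumberTheory.Automorphic.InfinityType L m, π.1.HasInfinityType T ∧ ∀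 (σ : L →+* ℂ) (a : ℂ), ((T σ).map Literature.NumberTheory.Automorphic.ArchWeight.a).count a ≤ 2) → ∀ (ℓ : ℕ) [Fact ℓ.Prime] (ι : PadicAlgCl ℓ ≃+* ℂ), ∃ ρ : Literature.NumberTheory.GaloisRepresentations.FramedGaloisRep L (PadicAlgCl ℓ) m, ρ.toGaloisRep.IsIrreducible ∧ Summit.Langlands.IsGeometricFramed RdL ρ ∧ Summit.Langlands.Corresponds RdL ι π.1 ρ ∧ ∀ ρ' : Literature.NumberTheory.GaloisRepresentations.FramedGaloisRep L (PadicAlgCl ℓ) m, Summit.Langlands.Corresponds RdL ι π.1 ρ' → Summit.Langlands.IsConjugate ρ ρ') ∧ (∀ (ℓ : ℕ) [Fact ℓ.Prime] (ι : PadicAlgCl ℓ ≃+* ℂ) (ρ : Literature.NumberTheory.GaloisRepresentations.FramedGaloisRep L (PadicAlgCl ℓ) m), ρ.toGaloisRep.IsIrreducible → Summit.Langlands.IsGeometricFramed RdL ρ → (∀ (v : IsDedekindDomain.HeightOneSpectrum (NumberField.RingOfIntegers L)) (hv : ((ℓ : ℕ) : NumberField.RingOfIntegers L) ∈ v.asIdeal)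 (τ : v.adicCompletion L →+* PadicAlgCl ℓ), Continuous τ → ∀ w : ℤ, (ρ.labelledHodgeTateWeightsAt v (Literature.NumberTheory.PAdicHodge.fontainePstAdicCompletion v ℓ hv).algebra (Literature.NumberTheory.PAdicHodge.fontainePstAdicCompletion v ℓ hv).𝔅 τ).count w ≤ 2) → ∃ π : Literature.NumberTheory.Automorphic.CuspidalAutomorphicRepData m L hcptL, π.1.IsLAlgebraic ∧ Summit.Langlands.Corresponds RdL ι π.1 ρ)) → (∀ (ℓ : ℕ) [Fact ℓ.Prime] (ι : PadicAlgCl ℓ ≃+* ℂ) (ρ : Literature.NumberTheory.GaloisRepresentations.FramedGaloisRep F (PadicAlgCl ℓ) n), ρ.toGaloisRep.IsIrreducible → Summit.Langlands.IsGeometricFramed Rd ρ → (((¬ (∀ (v : IsDedekindDomain.HeightOneSpectrum (NumberField.RingOfIntegers F)) (hv : ((ℓ : ℕ) : NumberField.RingOfIntegers F) ∈ v.asIdeal) (τ : v.adicCompletion F →+* PadicAlgCl ℓ), Continuous τ → ∀ w : ℤ, (ρ.labelledHodgeTateWeightsAt v (Literature.NumberTheory.PAdicHodge.fontainePstAdicCompletion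 v ℓ hv).algebra (Literature.NumberTheory.PAdicHodge.fontainePstAdicCompletion v ℓ hv).𝔅 τ).count w ≤ 1) ∧ (∀ (v : IsDedekindDomain.HeightOneSpectrum (NumberField.RingOfIntegers F)) (hv : ((ℓ : ℕ) : NumberField.RingOfIntegers F) ∈ v.asIdeal) (τ : v.adicCompletion F →+* PadicAlgCl ℓ), Continuous τ → ∀ w : ℤ, (ρ.labelledHodgeTateWeightsAt v (Literature.NumberTheory.PAdicHodge.fontainePstAdicCompletion v ℓ hv).algebra (Literature.NumberTheory.PAdicHodge.fontainePstAdicCompletion v ℓ hv).𝔅 τ).count w ≤ 2)) ∧ (¬ (∃ (L : Type) (_ : Field L) (_ : NumberField L) (_ : Algebra F L), ∀ σ : Field.absoluteGaloisGroup L, ∃ c : PadicAlgCl ℓ, ((ρ.restrictField L σ : GL (Fin n) (PadicAlgCl ℓ)) : Matrix (Fin n) (Fin n) (PadicAlgCl ℓ)) = c • (1 : Matrix (Fin n) (Fin n) (PadicAlgCl ℓ))) ∧ (∀ (L : Type) [Field L] [NumberField L] [Algebra F L], (ρ.restrictField L).toGaloisRep.IsIrreducible))) ∧ ((∀ (v :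 IsDedekindDomain.HeightOneSpectrum (NumberField.RingOfIntegers F)) (hv : ((ℓ : ℕ) : NumberField.RingOfIntegers F) ∈ v.asIdeal) (τ : v.adicCompletion F →+* PadicAlgCl ℓ), Continuous τ → ∃ a : ℤ, ∀ w ∈ (ρ.labelledHodgeTateWeightsAt v (Literature.NumberTheory.PAdicHodge.fontainePstAdicCompletion v ℓ hv).algebra (Literature.NumberTheory.PAdicHodge.fontainePstAdicCompletion v ℓ hv).𝔅 τ), w = a ∨ w = a + 1) ∧ n ≤ 2)) → ∃ π : Literature.NumberTheory.Automorphic.CuspidalAutomorphicRepData n F hcpt, π.1.IsLAlgebraic ∧ Summit.Langlands.Corresponds Rd ι π.1 ρ)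

/-- item stmt-Langlands-27006 · crux · rank 4 · open · by planner
why it might fail: No (B)-direction theorem exists for any non-regular U(2,1) weight; the only tools (GK19 strata Hasse invariants) go (A)-wards; off the conjugate-self-dual locus over CM fields there is not even a Shimura variety. Langlands-implied, so failure = no proof, not falsity.
sources: GoldringKoskivirta2019 = arXiv:1507.05032 [corpus:paper:arxiv-1507.05032 p.18 Thm 3.5.1, §3.5.2 unitary similitude groups], Carayol1998 (Compos. Math. 111: degenerate LDS on U(2,1), Griffiths–Schmid varieties) via [corpus:book:green2012-mumford-tate-groups-domains-their-geometry-arithmetic p.27 L15–19, p.146 L3], arXiv:1711.03196 (V. Hernandez, families of Picard modular forms), Literature/Barriers/Langlands/ShimuraVarietyRealizationBarrier.lean, Literature/Barriers/Langlands/NonRegularWeightBarrier.lean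
[crux] MIN3 — PICARD / U(2,1) HODGE TYPE (IDEA-NEEDED; DECLARED RESIDUAL conjunct of this route).
Every cell is the host residual W_Prim = `WeightMultiplicitySplit.WallLieIrreducibleAutomorphy`
(stmt-Langlands-33605) VERBATIM with ONE extra conjunct on the bound ρ: GIVEN multiplicity-≤-2
reciprocity below rank n over every number field (the IH), clause (B) «Galois ⟹ cuspidal L-algebraic
automorphic with `Corresponds`» for the irreducible pinned-geometric ρ : Γ_F → GL_n(ℚ̄_ℓ) of WALL
Hodge–Tate type (a labelled weight of multiplicity 2, none of multiplicity ≥ 3) with PRIMITIVE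
INFINITE monodromy (Lie-irreducible, not potentially scalar) — every F, n, datum, level, ℓ, ι.
EXTRA: minuscule Hodge–Tate cocharacter and n = 3 (MINUSCULE means: at every v ∣ ℓ and every label τ
the labelled Hodge–Tate weights lie in {a_τ, a_τ+1} (⟺ ad∘μ_HT has weights in {−1,0,1}, Deligne's
(SV1) / Green–Griffiths–Kerr's «classical» condition (ii): the Hodge datum is of Shimura =
abelian-variety type)): labelled types {a,a,a+1} / {a,a+1,a+1} — never symmetric about w/2, so at a
self-conjugate label impossible for a pure Hodge-symmetric ρ: over F with a real place the cell is
EMPTY on paper (Hodge–Tate symmet -/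
@[route_item "route-Langlands-MinusculeHodgeTypeSplit", crux]
def MinusculeWallRankThreeAutomorphy : Prop :=
  ∀ (F : Type) [Field F] [NumberField F] (Rd : Summit.Langlands.ReciprocityData F) (n : ℕ), 0 < n → ∀ hcpt : Literature.NumberTheory.Automorphic.isCompact_glFiniteIntegralLevel n F, (∀ (m : ℕ), m < n → 0 < m → ∀ (L : Type) [Field L] [NumberField L] (RdL : Summit.Langlands.ReciprocityData L) (hcptL : Literature.NumberTheory.Automorphic.isCompact_glFiniteIntegralLevel m L), (∀ π : Literature.NumberTheory.Automorphic.CuspidalAutomorphicRepData m L hcptL, π.1.IsLAlgebraic → (∃ T : Literature.NumberTheory.Automorphic.InfinityType L m, π.1.HasInfinityType T ∧ ∀ (σ : L →+* ℂ) (a : ℂ), ((T σ).map Literature.NumberTheory.Automorphic.ArchWeight.a).count a ≤ 2) → ∀ (ℓ : ℕ) [Fact ℓ.Prime] (ι : PadicAlgCl ℓ ≃+* ℂ), ∃ ρ : Literature.NumberTheory.GaloisRepresentations.FramedGaloisRep L (PadicAlgCl ℓ) m, ρ.toGaloisRep.IsIrreducible ∧ Summit.Langlands.IsGeometricFramed RdL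 ρ ∧ Summit.Langlands.Corresponds RdL ι π.1 ρ ∧ ∀ ρ' : Literature.NumberTheory.GaloisRepresentations.FramedGaloisRep L (PadicAlgCl ℓ) m, Summit.Langlands.Corresponds RdL ι π.1 ρ' → Summit.Langlands.IsConjugate ρ ρ') ∧ (∀ (ℓ : ℕ) [Fact ℓ.Prime] (ι : PadicAlgCl ℓ ≃+* ℂ) (ρ : Literature.NumberTheory.GaloisRepresentations.FramedGaloisRep L (PadicAlgCl ℓ) m), ρ.toGaloisRep.IsIrreducible → Summit.Langlands.IsGeometricFramed RdL ρ → (∀ (v : IsDedekindDomain.HeightOneSpectrum (NumberField.RingOfIntegers L)) (hv : ((ℓ : ℕ) : NumberField.RingOfIntegers L) ∈ v.asIdeal) (τ : v.adicCompletion L →+* PadicAlgCl ℓ), Continuous τ → ∀ w : ℤ, (ρ.labelledHodgeTateWeightsAt v (Literature.NumberTheory.PAdicHodge.fontainePstAdicCompletion v ℓ hv).algebra (Literature.NumberTheory.PAdicHodge.fontainePstAdicCompletion v ℓ hv).𝔅 τ).count w ≤ 2) → ∃ π : Literature.NumberTheory.Automorphic.CuspidalAutomorphicRepData m L hcptL,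 π.1.IsLAlgebraic ∧ Summit.Langlands.Corresponds RdL ι π.1 ρ)) → (∀ (ℓ : ℕ) [Fact ℓ.Prime] (ι : PadicAlgCl ℓ ≃+* ℂ) (ρ : Literature.NumberTheory.GaloisRepresentations.FramedGaloisRep F (PadicAlgCl ℓ) n), ρ.toGaloisRep.IsIrreducible → Summit.Langlands.IsGeometricFramed Rd ρ → (((¬ (∀ (v : IsDedekindDomain.HeightOneSpectrum (NumberField.RingOfIntegers F)) (hv : ((ℓ : ℕ) : NumberField.RingOfIntegers F) ∈ v.asIdeal) (τ : v.adicCompletion F →+* PadicAlgCl ℓ), Continuous τ → ∀ w : ℤ, (ρ.labelledHodgeTateWeightsAt v (Literature.NumberTheory.PAdicHodge.fontainePstAdicCompletion v ℓ hv).algebra (Literature.NumberTheory.PAdicHodge.fontainePstAdicCompletion v ℓ hv).𝔅 τ).count w ≤ 1) ∧ (∀ (v : IsDedekindDomain.HeightOneSpectrum (NumberField.RingOfIntegers F)) (hv : ((ℓ : ℕ) : NumberField.RingOfIntegers F) ∈ v.asIdeal) (τ : v.adicCompletion F →+* PadicAlgCl ℓ), Continuous τ → ∀ w : ℤ, (ρ.labelledHodgeTateWeightsAt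 v (Literature.NumberTheory.PAdicHodge.fontainePstAdicCompletion v ℓ hv).algebra (Literature.NumberTheory.PAdicHodge.fontainePstAdicCompletion v ℓ hv).𝔅 τ).count w ≤ 2)) ∧ (¬ (∃ (L : Type) (_ : Field L) (_ : NumberField L) (_ : Algebra F L), ∀ σ : Field.absoluteGaloisGroup L, ∃ c : PadicAlgCl ℓ, ((ρ.restrictField L σ : GL (Fin n) (PadicAlgCl ℓ)) : Matrix (Fin n) (Fin n) (PadicAlgCl ℓ)) = c • (1 : Matrix (Fin n) (Fin n) (PadicAlgCl ℓ))) ∧ (∀ (L : Type) [Field L] [NumberField L] [Algebra F L], (ρ.restrictField L).toGaloisRep.IsIrreducible))) ∧ ((∀ (v : IsDedekindDomain.HeightOneSpectrum (NumberField.RingOfIntegers F)) (hv : ((ℓ : ℕ) : NumberField.RingOfIntegers F) ∈ v.asIdeal) (τ : v.adicCompletion F →+* PadicAlgCl ℓ), Continuous τ → ∃ a : ℤ, ∀ w ∈ (ρ.labelledHodgeTateWeightsAt v (Literature.NumberTheory.PAdicHodge.fontainePstAdicCompletion v ℓ hv).algebra (Literature.NumberTheory.PAdicHodge.fontainePstAdicCompletion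 v ℓ hv).𝔅 τ), w = a ∨ w = a + 1) ∧ n = 3)) → ∃ π : Literature.NumberTheory.Automorphic.CuspidalAutomorphicRepData n F hcpt, π.1.IsLAlgebraic ∧ Summit.Langlands.Corresponds Rd ι π.1 ρ)

/-- item stmt-Langlands-27007 · crux · rank 5 · open · by planner
why it might fail: Head-on inside NonRegularWeightBarrier with no family witness (FamilyWitnessConsecutiveWeights: gapped weights admit none) and no Shimura realisation; beyond CG18's minimal cases nothing is known in any rank; Langlands-implied (kernel), so the risk is sterility, not falsity.
sources: Literature/Barriers/Langlands/NonRegularWeightBarrier.lean (NonRegularWeightBarrier_holds, NonRegularWeightBarrierNarrow_holds), Literature/Barriers/Langlands/FamilyWitnessConsecutiveWeights.lean (FamilyWitnessConsecutiveWeights_holds), Literature/Barriers/Langlands/ShimuraVarietyRealizationBarrier.lean, CalegariGeraghty2018 = arXiv:1207.4224 (minimal lifting, GSp4 weights [0,0,k-1,k-1]) via [corpus:paper:arxiv-2109.14145 p.27 L20–25], [corpus:book:green2012-mumford-tate-groups-domains-their-geometry-arithmetic p.17 L1–3, p.18 L13 (classical ⟺ Hermitian symmetric + characters z,1,z⁻¹),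 p.27 L15–19 (Carayol, degenerate LDS)], arXiv:2111.04834 [corpus:paper:arxiv-2111.04834 p.30]
[crux] R — NON-MINUSCULE WALL TYPES = the GRIFFITHS-RIGID RESIDUAL (DECLARED RESIDUAL of this route;
BARRIER · IDEA-NEEDED). Every cell is the host residual W_Prim =
`WeightMultiplicitySplit.WallLieIrreducibleAutomorphy` (stmt-Langlands-33605) VERBATIM with ONE
extra conjunct on the bound ρ: GIVEN multiplicity-≤-2 reciprocity below rank n over every number
field (the IH), clause (B) «Galois ⟹ cuspidal L-algebraic automorphic with `Corresponds`» for the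
irreducible pinned-geometric ρ : Γ_F → GL_n(ℚ̄_ℓ) of WALL Hodge–Tate type (a labelled weight of
multiplicity 2, none of multiplicity ≥ 3) with PRIMITIVE INFINITE monodromy (Lie-irreducible, not
potentially scalar) — every F, n, datum, level, ℓ, ι. EXTRA: NOT (minuscule ∧ n ≤ 4): at some label
the Hodge–Tate cocharacter has a gap ≥ 2 (Hodge length ≥ 2) — partial weight one {a,a}|{b,b+k},
(k,2)-Siegel type {a,a,a+k−1,a+k−1} (k ≥ 3; incl. the GAPPED Calegari–Geraghty types [0,0,k−1,k−1],
k ≥ 4, with MINIMAL lifting in print via Lan–Suh vanishing), non-minuscule U(2,1) types {a,a,a+k},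
and EVERY wall type of rank ≥ 5 — plus the paper-empty phantom «minuscule of rank ≥ 5» (a minuscule
multiset with multiplicities ≤ 2 has ≤ 4 elements: ker -/
@[route_item "route-Langlands-MinusculeHodgeTypeSplit", crux]
def NonMinusculeWallAutomorphy : Prop :=
  ∀ (F : Type) [Field F] [NumberField F] (Rd : Summit.Langlands.ReciprocityData F) (n : ℕ), 0 < n → ∀ hcpt : Literature.NumberTheory.Automorphic.isCompact_glFiniteIntegralLevel n F, (∀ (m : ℕ), m < n → 0 < m → ∀ (L : Type) [Field L] [NumberField L] (RdL : Summit.Langlands.ReciprocityData L) (hcptL : Literature.NumberTheory.Automorphic.isCompact_glFiniteIntegralLevel m L), (∀ π : Literature.NumberTheory.Automorphic.CuspidalAutomorphicRepData m L hcptL, π.1.IsLAlgebraic → (∃ T : Literature.NumberTheory.Automorphic.InfinityType L m, π.1.HasInfinityType T ∧ ∀ (σ : L →+* ℂ) (a : ℂ), ((T σ).map Literature.NumberTheory.Automorphic.ArchWeight.a).count a ≤ 2) → ∀ (ℓ : ℕ) [Fact ℓ.Prime] (ι : PadicAlgCl ℓ ≃+* ℂ), ∃ ρ : Literature.NumberTheory.GaloisRepresentations.FramedGaloisRep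 L (PadicAlgCl ℓ) m, ρ.toGaloisRep.IsIrreducible ∧ Summit.Langlands.IsGeometricFramed RdL ρ ∧ Summit.Langlands.Corresponds RdL ι π.1 ρ ∧ ∀ ρ' : Literature.NumberTheory.GaloisRepresentations.FramedGaloisRep L (PadicAlgCl ℓ) m, Summit.Langlands.Corresponds RdL ι π.1 ρ' → Summit.Langlands.IsConjugate ρ ρ') ∧ (∀ (ℓ : ℕ) [Fact ℓ.Prime] (ι : PadicAlgCl ℓ ≃+* ℂ) (ρ : Literature.NumberTheory.GaloisRepresentations.FramedGaloisRep L (PadicAlgCl ℓ) m), ρ.toGaloisRep.IsIrreducible → Summit.Langlands.IsGeometricFramed RdL ρ → (∀ (v : IsDedekindDomain.HeightOneSpectrum (NumberField.RingOfIntegers L)) (hv : ((ℓ : ℕ) : NumberField.RingOfIntegers L) ∈ v.asIdeal) (τ : v.adicCompletion L →+* PadicAlgCl ℓ), Continuous τ → ∀ w : ℤ, (ρ.labelledHodgeTateWeightsAt v (Literature.NumberTheory.PAdicHodge.fontainePstAdicCompletion v ℓ hv).algebra (Literature.NumberTheory.PAdicHodge.fontainePstAdicCompletion v ℓ hv).𝔅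 τ).count w ≤ 2) → ∃ π : Literature.NumberTheory.Automorphic.CuspidalAutomorphicRepData m L hcptL, π.1.IsLAlgebraic ∧ Summit.Langlands.Corresponds RdL ι π.1 ρ)) → (∀ (ℓ : ℕ) [Fact ℓ.Prime] (ι : PadicAlgCl ℓ ≃+* ℂ) (ρ : Literature.NumberTheory.GaloisRepresentations.FramedGaloisRep F (PadicAlgCl ℓ) n), ρ.toGaloisRep.IsIrreducible → Summit.Langlands.IsGeometricFramed Rd ρ → (((¬ (∀ (v : IsDedekindDomain.HeightOneSpectrum (NumberField.RingOfIntegers F)) (hv : ((ℓ : ℕ) : NumberField.RingOfIntegers F) ∈ v.asIdeal) (τ : v.adicCompletion F →+* PadicAlgCl ℓ), Continuous τ → ∀ w : ℤ, (ρ.labelledHodgeTateWeightsAt v (Literature.NumberTheory.PAdicHodge.fontainePstAdicCompletion v ℓ hv).algebra (Literature.NumberTheory.PAdicHodge.fontainePstAdicCompletion v ℓ hv).𝔅 τ).count w ≤ 1) ∧ (∀ (v : IsDedekindDomain.HeightOneSpectrum (NumberField.RingOfIntegers F)) (hv : ((ℓ : ℕ) : NumberField.RingOfIntegers F) ∈ v.asIdeal)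 (τ : v.adicCompletion F →+* PadicAlgCl ℓ), Continuous τ → ∀ w : ℤ, (ρ.labelledHodgeTateWeightsAt v (Literature.NumberTheory.PAdicHodge.fontainePstAdicCompletion v ℓ hv).algebra (Literature.NumberTheory.PAdicHodge.fontainePstAdicCompletion v ℓ hv).𝔅 τ).count w ≤ 2)) ∧ (¬ (∃ (L : Type) (_ : Field L) (_ : NumberField L) (_ : Algebra F L), ∀ σ : Field.absoluteGaloisGroup L, ∃ c : PadicAlgCl ℓ, ((ρ.restrictField L σ : GL (Fin n) (PadicAlgCl ℓ)) : Matrix (Fin n) (Fin n) (PadicAlgCl ℓ)) = c • (1 : Matrix (Fin n) (Fin n) (PadicAlgCl ℓ))) ∧ (∀ (L : Type) [Field L] [NumberField L] [Algebra F L], (ρ.restrictField L).toGaloisRep.IsIrreducible))) ∧ ¬ ((∀ (v : IsDedekindDomain.HeightOneSpectrum (NumberField.RingOfIntegers F)) (hv : ((ℓ : ℕ) : NumberField.RingOfIntegers F) ∈ v.asIdeal) (τ : v.adicCompletion F →+* PadicAlgCl ℓ), Continuous τ → ∃ a : ℤ, ∀ w ∈ (ρ.labelledHodgeTateWeightsAt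 v (Literature.NumberTheory.PAdicHodge.fontainePstAdicCompletion v ℓ hv).algebra (Literature.NumberTheory.PAdicHodge.fontainePstAdicCompletion v ℓ hv).𝔅 τ), w = a ∨ w = a + 1) ∧ n ≤ 4)) → ∃ π : Literature.NumberTheory.Automorphic.CuspidalAutomorphicRepData n F hcpt, π.1.IsLAlgebraic ∧ Summit.Langlands.Corresponds Rd ι π.1 ρ)

/-- item stmt-Langlands-27008 · support · rank 9 · open · by planner
sources: Summit.Langlands.Langlands.Theses.WeightMultiplicitySplit.closes (rev 2 @2e058443), Summit.Langlands.Langlands.Theorems.WeightMultiplicitySplit_WallWeightReciprocity_of_split_proof (p776639 @0861d620de3e), BuzzardGeeLMS2014 Conj. 3.2.1/3.2.2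
[support] FRAME (content = the HOST ROUTE below W_Prim, VERBATIM as one implication BY NAME):
`WeightMultiplicitySplit.WallLieIrreducibleAutomorphy → Langlands`, i.e. the host route
route-Langlands-WeightMultiplicitySplit rev 2 with W_Prim discharged — G `GenericWeightReciprocity`
24355, the W-siblings W_A 33602, W_Fin 33603, W_Str 33604 (→ W 24354 by the LANDED split glue
`Theorems.WeightMultiplicitySplit_WallWeightReciprocity_of_split_proof`, item 33607 CLOSED p776639,
with the feed G♭ ⟸ G by one line), D `DegenerateWeightReciprocity` 24356, and the host's certified
`WeightMultiplicitySplit.closes : G → W → D → Langlands`. Certified in the node: `frame_of_host : G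
→ W_A → W_Fin → W_Str → D → FRAME` (0 sorry, standard axioms); Langlands ⟹ FRAME trivially (a
consequence of S used toward S; bc7 informational S → C). Same device as
TameDarkSplit.NonRegularizableFrame and PotentialCompanionDescent.LieIrreducibleCompanionFrame
(L601/L640 precedent). [difficulty: open-problem = the host route] [TAGS: imported complement;
residual for the tribunal's conjunct reading] -/
@[route_item "route-Langlands-MinusculeHodgeTypeSplit", crux]
def WallLieIrreducibleFrame : Prop :=
  Summit.Langlands.Langlands.Theses.WeightMultiplicitySplit.WallLieIrreducibleAutomorphy → _root_.Langlands

/-- item stmt-Langlands-27009 · assembly · rank 1 · closed · proved by Summit.Langlands.Langlands.Theorems.minusculeHodgeTypeSplit_assembly_proof (prover) · by planner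
[assembly] the curried form of `closes` (ORDER-FREE, pure logic: excluded middle on the inlined dial
«minuscule ∧ n ≤ 4», `omega` on the rank, then FRAME; = node kernel `wallLieIrreducible_of_cells` +
modus ponens). [deps: MinusculeWallRankTwoAutomorphy, MinusculeWallRankThreeAutomorphy,
MinusculeWallRankFourAutomorphy, NonMinusculeWallAutomorphy, WallLieIrreducibleFrame] -/
@[route_item "route-Langlands-MinusculeHodgeTypeSplit"]
def Assembly : Prop :=
  MinusculeWallRankTwoAutomorphy → MinusculeWallRankThreeAutomorphy → MinusculeWallRankFourAutomorphy → NonMinusculeWallAutomorphy → WallLieIrreducibleFrame → _root_.Langlands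

-- `Assembly` holds: proved by `Summit.Langlands.Langlands.Theorems.minusculeHodgeTypeSplit_assembly_proof` (its module imports this route file, so no `_holds` link can be stated here).

/-! D-0027 §2.1 — DECIDING THEOREM (planner-authored via `route open/edit --closes-file`; by planner-decomp-langlands-writer-1-g4-0 2026-08-30T16:25:41Z):
its hypotheses are this route's items and its conclusion the sub-problem Statement (glue_lint), and it elaborates with this file. -/

/- Deciding theorem of the CHILD ROUTE `MinusculeHodgeTypeSplit` (refines W_Prim = WeightMultiplicitySplit.WallLieIrreducibleAutomorphy, stmt-Langlands-33605):
the four cells + the frame ⟹ `_root_.Langlands` BY NAME.  Pure logic, inline (= node kernel `closes` VERBATIM): excluded middle on the inlined dial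
«minuscule ∧ n ≤ 4» (its text is INFERRED from the residual's hypothesis — never restated), `omega` on the rank, modus ponens through the frame. -/
@[closes "route-Langlands-MinusculeHodgeTypeSplit"] theorem closes (h2 : MinusculeWallRankTwoAutomorphy) (h3 : MinusculeWallRankThreeAutomorphy) (h4 : MinusculeWallRankFourAutomorphy)
    (hR : NonMinusculeWallAutomorphy) (hF : WallLieIrreducibleFrame) : _root_.Langlands := by
  refine hF ?_
  intro F _ _ Rd n hn hcpt hIH ℓ _ ι ρ hirr hgeo hQ
  refine Classical.byCases (fun hM => ?_) (fun hM => hR F Rd n hn hcpt hIH ℓ ι ρ hirr hgeo ⟨hQ, hM⟩)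
  obtain ⟨hMin, hn4⟩ := hM
  obtain h | h | h : n ≤ 2 ∨ n = 3 ∨ n = 4 := by omega
  · exact h2 F Rd n hn hcpt hIH ℓ ι ρ hirr hgeo ⟨hQ, hMin, h⟩
  · exact h3 F Rd n hn hcpt hIH ℓ ι ρ hirr hgeo ⟨hQ, hMin, h⟩
  · exact h4 F Rd n hn hcpt hIH ℓ ι ρ hirr hgeo ⟨hQ, hMin, h⟩

end Summit.Langlands.Langlands.Theses.MinusculeHodgeTypeSplit
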